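import Mathlib.NumberTheory.Padics.Complex
import Literature.NumberTheory.EllipticCurves.ModularSymbols
import Literature.NumberTheory.EllipticCurves.PAdicLFunction
import Literature.NumberTheory.EllipticCurves.GaloisAction
import HarnessLib

/-!
# Congruent weight-two eigenforms have congruent canonically normalised plus modular symbols
# (Vatsal 1999, §1: (1.1)–(1.7), Remark (1.12), Theorem (1.13))

Topic `NumberTheory/EllipticCurves` (next to `ModularSymbols.lean`, `StabilisedLevelLoweringCongruence.lean`,
`ModularJacobianModPMultiplicityOne.lean`); namespace `Literature.NumberTheory.EllipticCurves.ModularForms`.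
TWO named facts (`vatsal1999_plusSymbol_congruence` — level prime to `p`; `greenbergVatsal2000_plusSymbol_congruence` —
the semistable-at-`p` variant for the Hecke family of an elliptic curve, ADDED 2026-08-26T23:xxZ on the consumer's
ask «p ∤ N or the semistable-at-p variant»), `def … : Prop` (CONVENTIONS §4), and ONE definition with body
(`HasSimpleHeckeGenEigenspace`, Vatsal's "Condition 1"), plus proved bookkeeping lemmas. Written by the
`bsd-litref` typer seat `jsw17-ty` (g2) for `bsd-addord-plan` g17's WANTED (3) («ONE named fact = symbol-wise
multiplicity-one / canonical-period congruence of plus modular symbols for congruent weight-2 eigenforms»,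
pub/bsd-addord/STATUS.md l.882; relayed by `bsd-litref-lead` 2026-08-26T19:34:17Z); consumers: the route-W2
level-lowering assembly `--supports stmt-BirchSwinnertonDyer-19679` over the predicate
`Literature.NumberTheory.EllipticCurves.IsStabilisedLevelLoweringCongruence` (`StabilisedLevelLoweringCongruence.lean`).

## The source and what is typed (loci = the author's copy of the published paper)

V. Vatsal, *Canonical periods and congruence formulae*, Duke Math. J. **98** (1999) 397–419
[Vatsal1999]; text read first-hand in the author's copy `https://personal.math.ubc.ca/~vatsal/research/bah.PDF`
(lit store key `paper:url-35ccf3ae8117`, 20 pp.; theorem numbering as published — it agrees with the citations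
«[Vat97], Theorems 1.3 and 2.7», «Theorem 1.10 of [Vat97]» in Greenberg–Vatsal 2000 §3). Page/line locators
`pNNNN:Lnn` below refer to that key.

* NOTATION (p0003 L33–L39): «Let `p` be an odd prime, and `N` a positive integer prime to `p`. We set `M = Np^s`
  … and assume throughout that `M ≥ 4`. Let `Γ` denote the group `Γ₁(M)` … We also fix an isomorphism `ℂ_p ≅ ℂ`,
  together with an embedding `ℚ̄ ↪ ℂ`. We let `K` denote a finite extension of `ℚ_p` and write `𝒪` for the ring
  of integers in `K` … `π` for a generator of the maximal ideal of `𝒪`.»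
* (1.1) (p0004 L21–L31): «Let `f = ∑ aₙqⁿ`, `g = ∑ bₙqⁿ` be normalized Hecke eigenforms on `Γ` of weight `k ≥ 2`,
  with coefficients in `𝒪`, and such that `aₙ ≡ bₙ (mod π^r)` for some integer `r ≥ 1`. We do not assume at
  present that either `f` or `g` is a newform … the congruence class of `f` and `g` in `S_k` determines a maximal
  ideal `𝔪` of `T_k`, and a residual representation `ρ_𝔪` … such that `Tr(Frob(q)) = T_q` for all primes `q`
  with `(Np, q) = 1`. In this section we assume that `ρ_𝔪` is irreducible.»
* (1.2) (p0004 L39–p0005 L4), the two CONDITIONS: «1. `R_f = R_g = K`» (the local factors of the Artin algebra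
  `T_{k,𝔪} ⊗ ℚ` through which the eigencharacters `π_f, π_g` factor are the field `K` — equivalently: the
  generalised Hecke eigenspace of `f`, resp. `g`, is a line; typed below as the DEFINITION
  `HasSimpleHeckeGenEigenspace`), and «2. There exist isomorphisms of `T_k`-modules
  `φ^± : H¹(Γ, L_n(𝒪))^±_𝔪 = H¹_p(Γ, L_n(𝒪))^±_𝔪 ≅ T*_{k,𝔪} = Hom_𝒪(T_{k,𝔪}, 𝒪)`» (MULTIPLICITY ONE). «The
  first condition will be satisfied if, for example, both `f` and `g` are new of level `M`, but can often be
  checked in other situations.»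
* (1.3) (p0005 L19–L33): the isomorphisms `θ^± : H¹(Γ, L_n(𝒪))^±_𝔪 ≅ S_k(𝒪)_𝔪` (3), the cocycles `δ^±_h` with
  `θ^±(δ^±_h) = h`, display (4) «Since we have `f ≡ g (mod π^r)`, we will have `δ^±_f ≡ δ^±_g (mod π^r)` for
  each choice of sign», and display (5) `ω^±_* = Ω^±_* δ^±_*`: «The numbers `Ω^±_*` are the canonical periods
  alluded to in the title. We note, however, they are only determined up to `p`-adic units.»
* (1.5)–(1.6) (p0006 L40–p0007 L30): modular symbols `S_Γ(A) = Hom_Γ(D⁰, A)`, the boundary sequence (9), the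
  operator `η_q = T_q − 1 − ⟨q⟩` (`q ≡ 1 mod Np`) killing boundary symbols, and (p0007 L25–L30): «we obtain
  modular symbols `Δ^±_*` with values in `L_n(𝒪)`, and we will have **`Δ^±_f ≡ Δ^±_g (mod π^r)`**. Naturality of
  the sequence (9) then implies the following algebraicity result: `η_q(*) L(*, χ)/Ω^±_* = L(Δ^±_*, χ) ∈ L_n(𝒪)`
  (11) … we may choose `q` so that `η_q(*)` is a `p`-adic unit, for both `f` and `g` … `η_q(f) ≡ η_q(g)
  (mod π^r)`», whence Prop. (1.7) (p0007 L36–L44, the twisted-`L`-value congruence for EVERY Dirichlet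
  character). THIS is the symbol-wise statement typed below: the `𝒪`-valued modular symbols
  `x ↦ Φ^+_*({x} − {∞})/Ω^+_*` (`Φ_*` the complex modular symbol of `*`, `+` = the part fixed by complex
  conjugation `x ↦ −x`) of `f` and of `g` are `𝒪`-INTEGRAL and CONGRUENT modulo the maximal ideal, value by
  value.
* Remark (1.12) (p0009 L13–L27): «for any choice `α` of sign, there exists at least one twist `χ` of parity `α`
  with `τ(χ̄) L(1, *, χ)/(−2πi Ω^α_*) ≢ 0 (mod π)`. When the weight `k` is two, this will follow from a result
  of Stevens … one has only to check that the cocycle `δ^±_*` is nonzero in `H¹(Γ, A) ⊗ 𝒪/π`. But this follows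
  from Condition 2, as the form `*` is not divisible by `π` in `S₂(𝒪)`.» Typed as the NON-VANISHING clause
  (some plus-symbol value of `f` is a `p`-adic unit: a twisted value is a `ℤ[χ]`-combination of symbol values).
* Theorem (1.13) (p0009 L55–p0010 L3; its proof says «criteria for Condition 2»): Condition 2 «is valid in
  each of the following situations: • `M = N` is prime to `p` and `p > k` [Faltings–Jordan 1995, Thm. 2.1];
  • `M = Np`, `𝔪` is ordinary, and the Jordan–Hölder factors of `ρ_𝔪` are distinct on a decomposition group
  `D_p` [Wiles 1995, Thm. 2.1 for `k = 2`].» The FIRST bullet gives `vatsal1999_plusSymbol_congruence` (hypotheses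
  `¬ p ∣ M`, `p` odd `> 2 = k`); the SECOND bullet is typed in the elliptic-curve form in which Greenberg–Vatsal
  PRINT it (next paragraph) as `greenbergVatsal2000_plusSymbol_congruence`.

REFEREED RESTATEMENT IN ELLIPTIC-CURVE LANGUAGE (the cite of record for the SECOND fact's Condition 2; context for
the first): R. Greenberg, V. Vatsal, Invent. Math. 142 (2000) §3 [GreenbergVatsal2000] (arXiv:math/9906215, store
`paper:arxiv-math_9906215`; decoded pages pub/bsd-addord/bsd-addord-twist-gv2000-decoded.txt p. 31–33): standing (p. 31–32)
«Let `E` be a modular elliptic curve of conductor `N`, and let `p` be a fixed odd prime. We assume that `E` has either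
good ordinary or multiplicative reduction at `p` … `Γ₁(N)`; we may assume that `N > 4`, so that `Γ` is torsion-free»;
sign (17)ff «1. If `E[p]` is irreducible, then `α` is arbitrary … A choice of sign satisfying one of these conditions
is said to be admissible»; then (p. 33) «let `f = ∑ aₙqⁿ` denote the newform associated to `E`. Let `M` be any integer
divisible by `N`, and let `g = ∑ bₙqⁿ` denote any modular form of level `M` that is an eigenform for the full Hecke
algebra `T₁(M)` for `Γ₁(M)`, and which satisfies `aₙ = bₙ` whenever `(n, M) = 1`. If `α` is admissible, it follows
from work of Mazur, Ribet, Wiles, and others (see [Vat97], Theorems 1.3 and 2.7) that there is an isomorphism of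
`T₁(M)_𝔪`-modules» —
display (18) `δ^α : S₂(Γ₁(M); ℤ_p)_𝔪 ≅ H¹_par(Γ₁(M); ℤ_p)^α_𝔪` — i.e. Vatsal's CONDITION 2 for the maximal ideal `𝔪`
of such a `g` (p. 32: the `p`-distinguishedness and semistability provisos of [Vat97] Thm. 2.7 «will be true … if
`(N, p) = 1`, or if `f` corresponds to an elliptic curve»); (19) canonical periods; proof of Thm. (3.10) (p. 41): «`a'ₙ ≡ b'ₙ (mod p)` for all integers `n`.
Theorem 1.10 of [Vat97] now yields a congruence …»; Prop. (3.1)/Remark (3.4)/Thm. (3.2) (= Mazur 1978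
Cor. 4.1): for `E[p]` irreducible and `p` odd good ordinary or multiplicative, the Néron period of ANY curve in
the isogeny class, hence the lattice period `Ω⁺_f = plusPeriod f` of the strong Weil curve, equals the
canonical period up to a `p`-adic unit — the bridge from the conclusion below to the tree's
`ratPlusSymbol f x = plusSymbol f x/Ω⁺_f` when a UNIT is wanted; without it a consumer still gets
`[x]⁺_f ≡ c̄·φ(x)` with `c̄` possibly `0`, from the `p`-integrality of `[x]⁺_f`). A verbatim modern restatement
of (1.6) («`φ^±_F ≡ φ^±_G mod ϖ^r` … lifts naturally to `Symb(Γ, L_{k−2}(𝒪))_𝔪`», via [FJ95] «provided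
`p ∤ M` and `p > k`») is the 2025 PREPRINT arXiv:2508.09733 §2.2 (store `paper:arxiv-2508.09733` p0007
L57–L75) — claim-level, not relied on. Emerton–Pollack–Weston 2006 Prop. 4.1.1/4.1.4 [EmertonPollackWeston2006]
print the Hida-family version (`M^±_𝔪` free of rank one; residual `L̄^±(𝔪, N)`) in MEASURE currency.

## The tree's reading (clause by clause) and the DELTA to print

* `Γ = Γ₁(M)`, weight `k`: typed for TRIVIAL NEBENTYPUS and WEIGHT 2 only — `f g : CuspForm (Gamma0 M) 2`
  (a `Γ₀(M)`-form is a `Γ₁(M)`-form on which every `⟨d⟩` acts trivially; its symbol values `{∞, x}` do not depend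
  on the group). `-- TODO(general form): Γ₁(M) with nebentypus, weight k ≥ 2 (values in L_{k−2}(𝒪)), sign −,
  modulus π^r with r ≥ 2, arbitrary divisors {c₁} − {c₂}; second bullet of Thm. (1.13) (p ∥ M, 𝔪 ordinary,
  ρ_𝔪|D_p distinguished — the multiplicative-at-p case, = GV (18) for E multiplicative at p).`
* «normalized Hecke eigenforms … with coefficients in `𝒪`»: `IsHeckeEigenform` (all `T_ℓ`, `ℓ` prime, `= U_ℓ`
  for `ℓ ∣ M`) `∧ IsNormalized`, the coefficient field a number field (`FiniteDimensional ℚ (coeffField ·)`, so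
  that a finite `K/ℚ_p` containing the coefficients exists) and `p`-INTEGRALITY of every `aₙ` read through a
  field isomorphism `ι : ℚ̄_p ≃+* ℂ` (the tree's stand-in for the fixed `ℂ_p ≅ ℂ`, as in
  `HeckeEigenvectorModPOfCongruence.lean`; `Valued.v` is the valuation of `ℚ̄_p = PadicAlgCl p`):
  `v(ι⁻¹ aₙ) ≤ 1`.
* «`aₙ ≡ bₙ (mod π^r)`», here `r = 1`: `v(ι⁻¹(aₙ(f) − aₙ(g))) < 1` for ALL `n` (membership in the maximal ideal
  of `𝒪_{ℚ̄_p}`, equivalently of `𝒪`, whatever the ramification of `K`).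
* Condition 1 «`R_f = K`»: `HasSimpleHeckeGenEigenspace f` — every cusp form on `Γ₀(M)` killed by a power of
  `T_ℓ − a_ℓ(f)` for every prime `ℓ` is a multiple of `f` (the generalised eigenspace of the eigencharacter of
  `f` in `S₂(Γ₀(M))` is the line `ℂf`; since the diamond operators are semisimple and commute with the `T_ℓ`,
  this is the same as the generalised eigenspace in `S₂(Γ₁(M))` for the character `⟨d⟩ ↦ 1`, `T_ℓ ↦ a_ℓ(f)`,
  i.e. `dim_K R_f = 1`). Automatic for newforms of level `M`; for old / stabilised / depleted eigenforms it is
  the consumer's check (semisimplicity of the `U`-operators on the old space), exactly as in print.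
* Condition 2: DISCHARGED by Thm. (1.13), first bullet — hypotheses `p ≠ 2`, `¬ p ∣ M` (and `k = 2 < p`).
* «`ρ_𝔪` is irreducible»: typed through an ELLIPTIC-CURVE WITNESS, the case the consumers are in: an elliptic
  curve `W/ℚ` with `W[p]` irreducible (`WeierstrassCurve.HasIrreducibleModPGaloisRep`, `GaloisAction.lean`, the
  predicate the `bsd-addord` files already carry at `p = 3`) and `a_ℓ(f) ≡ a_ℓ(W) (mod 𝔭)` for every prime
  `ℓ ∤ Mp` (`a_ℓ(W)` = Mathlib's `W.LFunction ℓ`, as in `IsNewformOf`). Then `ρ_𝔪 ⊗ k ≅ W[p] ⊗ k` (Chebotarev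
  and Brauer–Nesbitt on the primes `ℓ ∤ MpN_W`), and `W[p]` irreducible, odd, `p` odd ⇒ absolutely irreducible,
  so `ρ_𝔪` is irreducible: the typed hypothesis IMPLIES the printed one (the fact asks no more than print).
  `-- TODO(general form): ρ_𝔪 irreducible for an arbitrary residual eigensystem (ModPGaloisRep currency).`
* CONCLUSION (= (1.6) display «`Δ^±_f ≡ Δ^±_g`» + (11) + Rem. (1.12), sign `+`, on the divisors `{x} − {∞}`,
  `x ∈ ℚ`): there are `Ω_f, Ω_g ∈ ℂˣ` (the canonical periods `Ω⁺`, into which the harmless normalisation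
  constants — orientation `{∞, x}` vs `{x} − {∞}`, the factor `2πi`, the `½` in `plusSymbol`, and the units
  `η_q(*)⁻¹` — are absorbed) such that for all `x ∈ ℚ` the numbers `plusSymbol f x / Ω_f` and
  `plusSymbol g x / Ω_g` are `p`-integral, their difference lies in the maximal ideal, and some
  `plusSymbol f x / Ω_f` is a unit. The EXISTENTIAL over the periods and the restriction to `{∞, x}`-symbols make
  the typed statement a consequence of the printed one.

NOT typed, by design: the canonical periods as DEFINED objects (they need `H¹_par(Γ₁(M), 𝒪)_𝔪`, absent from
the tree), the modulus `π^r`, the `−` sign, `p ∣ M`. Nothing here is asserted about `ratPlusSymbol`/`plusPeriod`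
(the lattice normalisation): see the GV bridge above. PARTITION: 0 classes (types-the-object-of; route W2
`KimAtThreeKolyvagin`, items 19679 / 19599 / 19075 — B3 N11@3: `p = 3 ∤ M` is INSIDE the typed hypotheses;
the road's multiplicative-at-3 rows need the untyped second bullet). Nothing here proves BSD.

PRESEARCH (2026-08-26, corpus fts+vec AND galaxy AND citation graph): `lit galaxy search "Canonical periods and
congruence formulae" --star all` → Duke text not held (2 book hits citing it; Dummigan–Stein–Watkins restates
only the Faltings–Jordan central-value case); author copy located by a read-only GET of the author's page and
materialised (`paper:url-35ccf3ae8117`); `lit citing` (123 works) → Greenberg–Vatsal 2000 (held), Kim–Ota 2023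
(held, arXiv:1905.02926: Prop. 4.1 `(𝓜_{N,𝔪} ⊗ 𝔽)[𝔪]^∨ ≅ 𝔽²` «[faltings-jordan]. See also [vatsal-cong]», but
standing `p ≥ 5`), arXiv:2508.09733 (2025 preprint, §2.2 verbatim restatement), Bruinier–James–Kohnen–Ono–
Skinner–Vatsal 1999 Thm. 3 (= Vatsal Thm. 0.3, the Eisenstein case; held), Heumann–Vatsal 2014, Vatsal 2013;
`lit search --hybrid "Vatsal canonical periods congruence … modular symbols congruent eigenforms"` → books only
(Delbourgo 2008, Hida 2000). Tree (`lean search`): `wiles1995_multiplicityOne` (DDT Thm. 4.26, `J₀(N)[𝔪]`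
currency, covers `ℓ = 3`; its scope note leaves the passage to `Symb^±` to consumers),
`Summits/…/Rank1Residual/X4/KuriharaLevelLoweringOfMultiplicityOne.lean` (the (MO)+(OLD) ⇒
`[r]⁺_f ≡ c(μ(r) − wμ(ℓr))` assembly over DISPLAYED predicates), `GreenbergVatsal2000/*`,
`EmertonPollackWeston2006/*` (Iwasawa-invariant currency), `IsStabilisedLevelLoweringCongruence` (the consumer's
name); no decl states a symbol-wise congruence between two eigenforms — this file is not a restatement.

## References

* V. Vatsal, *Canonical periods and congruence formulae*, Duke Math. J. 98 (1999), 397–419: Notation, (1.1)–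
  (1.7), (11), Remark (1.12), Theorem (1.13). [Vatsal1999]
* R. Greenberg, V. Vatsal, *On the Iwasawa invariants of elliptic curves*, Invent. Math. 142 (2000), 17–63:
  §3 (18)–(19), Prop. (3.1), Thm. (3.2), Remark (3.4), Lemma (3.6), Thm. (3.10) and its proof, Thm. (3.13).
  [GreenbergVatsal2000]
* M. Emerton, R. Pollack, T. Weston, *Variation of Iwasawa invariants in Hida families*, Invent. Math. 163
  (2006): Prop. 4.1.1, Prop. 4.1.4. [EmertonPollackWeston2006]
* G. Faltings, B. Jordan, *Crystalline cohomology and GL(2, ℚ)*, Israel J. Math. 90 (1995), 1–66, Thm. 2.1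
  (Vatsal's source for Thm. (1.13), first bullet); A. Wiles, Ann. of Math. 141 (1995), Thm. 2.1 (second
  bullet). [Wiles1995Annals]
* C.-H. Kim, K. Ota, Res. Math. Sci. 10 (2023), Prop. 4.1 (arXiv:1905.02926). [KimOta2023]
-/

noncomputable section

open scoped MatrixGroups ModularForm

open CongruenceSubgroup

namespace Literature.NumberTheory.EllipticCurves.ModularForms

section ConditionOne

variable {M : ℕ} [NeZero M]

/-- **Vatsal's Condition 1 («`R_f = K`») for a weight-two eigenform `f` on `Γ₀(M)`**, read on
`S₂(Γ₀(M))`: the generalised eigenspace of the Hecke eigencharacter of `f` is the line `ℂ·f` — every cusp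
form `h` on `Γ₀(M)` that is killed, for every prime `ℓ`, by some power of `T_ℓ − a_ℓ(f)` (`T_ℓ = heckeT`,
`= U_ℓ` when `ℓ ∣ M`; `a_ℓ(f) = heckeEigenvalue f ℓ`) is a scalar multiple of `f`. Equivalently the local
factor `R_f` of the Artin algebra `T_𝔪 ⊗ K` through which `π_f` factors is the field `K`
(`S₂(K)_𝔪 ≅ Hom_K(T_𝔪 ⊗ K, K)`, the generalised `π_f`-eigenspace being `Hom_K(R_f, K)`). «The first condition
will be satisfied if, for example, both `f` and `g` are new of level `M`, but can often be checked in other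
situations.» [cite: Vatsal1999, (1.1)–(1.2), Condition 1] -/
def HasSimpleHeckeGenEigenspace (f : CuspForm (Gamma0 M) 2) : Prop :=
  ∀ h : CuspForm (Gamma0 M) 2,
    (∀ ℓ : ℕ, (hℓ : ℓ.Prime) → ∃ n : ℕ,
      (haveI : NeZero ℓ := ⟨hℓ.ne_zero⟩;
        ((heckeT (Gamma0 M) 2 ℓ - heckeEigenvalue f ℓ • (1 : Module.End ℂ (CuspForm (Gamma0 M) 2))) ^ n) h) = 0) →
    ∃ c : ℂ, h = c • f

/-- Unfolding `HasSimpleHeckeGenEigenspace` (Vatsal's Condition 1 read on `S₂(Γ₀(M))`). [cite: Vatsal1999, (1.2), Condition 1] -/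
theorem hasSimpleHeckeGenEigenspace_iff (f : CuspForm (Gamma0 M) 2) :
    HasSimpleHeckeGenEigenspace f ↔
      ∀ h : CuspForm (Gamma0 M) 2,
        (∀ ℓ : ℕ, (hℓ : ℓ.Prime) → ∃ n : ℕ,
          (haveI : NeZero ℓ := ⟨hℓ.ne_zero⟩;
            ((heckeT (Gamma0 M) 2 ℓ - heckeEigenvalue f ℓ • (1 : Module.End ℂ (CuspForm (Gamma0 M) 2))) ^ n) h) =
            0) →
        ∃ c : ℂ, h = c • f :=
  Iff.rfl

/-- Under Condition 1, an honest eigenvector with the eigenvalues of `f` (power `n = 1`) is a multiple of `f`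
(multiplicity one in characteristic `0` for the full Hecke algebra, as a special case). [cite: Vatsal1999, (1.2), Condition 1] -/
theorem HasSimpleHeckeGenEigenspace.eq_smul_of_heckeT_eq {f : CuspForm (Gamma0 M) 2}
    (hf : HasSimpleHeckeGenEigenspace f) {h : CuspForm (Gamma0 M) 2}
    (heig : ∀ ℓ : ℕ, (hℓ : ℓ.Prime) →
      (haveI : NeZero ℓ := ⟨hℓ.ne_zero⟩; heckeT (Gamma0 M) 2 ℓ h) = heckeEigenvalue f ℓ • h) :
    ∃ c : ℂ, h = c • f := by
  refine hf h fun ℓ hℓ ↦ ⟨1, ?_⟩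
  haveI : NeZero ℓ := ⟨hℓ.ne_zero⟩
  have := heig ℓ hℓ
  simp only [pow_one, LinearMap.sub_apply, LinearMap.smul_apply, Module.End.one_apply]
  rw [this, sub_self]

end ConditionOne

section Fact

/-- **Vatsal 1999, §1 — congruent weight-two eigenforms have congruent, integral, residually non-zero
canonically normalised plus modular symbols** ((1.6): «we obtain modular symbols `Δ^±_*` with values in
`L_n(𝒪)`, and we will have `Δ^±_f ≡ Δ^±_g (mod π^r)`», with (11), Remark (1.12) and Theorem (1.13), first
bullet; weight `2`, trivial nebentypus, sign `+`, `r = 1`, divisors `{x} − {∞}`). Let `p` be an odd prime and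
`M ≥ 4` with `p ∤ M`; fix a field isomorphism `ι : ℚ̄_p ≃ ℂ` (the printed «isomorphism `ℂ_p ≅ ℂ`»). Let
`f, g ∈ S₂(Γ₀(M))` be normalised Hecke eigenforms for all `T_ℓ` (`ℓ` prime; `U_ℓ` when `ℓ ∣ M`) — not
assumed new — whose coefficient fields are number fields and whose coefficients are `p`-integral
(«coefficients in `𝒪`»), with `aₙ(f) ≡ aₙ(g)` modulo the maximal ideal for ALL `n` («`aₙ ≡ bₙ (mod π)`»),
each satisfying Condition 1 (`HasSimpleHeckeGenEigenspace`), and such that the common residual eigensystem is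
that of an elliptic curve `W/ℚ` with `W[p]` IRREDUCIBLE: `a_ℓ(f) ≡ a_ℓ(W)` modulo the maximal ideal for every
prime `ℓ ∤ Mp` (so «`ρ_𝔪` is irreducible»). THEN there are `Ω_f, Ω_g ∈ ℂˣ` (the canonical periods `Ω⁺_f`,
`Ω⁺_g`, «only determined up to `p`-adic units») such that, for every `x ∈ ℚ`, `plusSymbol f x / Ω_f` and
`plusSymbol g x / Ω_g` are `p`-integral (read through `ι⁻¹`), their difference lies in the maximal ideal
(`Δ⁺_f ≡ Δ⁺_g`), and `plusSymbol f x / Ω_f` is a `p`-adic unit for at least one `x` (Remark (1.12)).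
[cite: Vatsal1999, §1: (1.1)–(1.3) with displays (3)–(5), (1.5)–(1.6) with display (11), Prop. (1.7), Remark (1.12), Thm. (1.13) first bullet]
[cite: GreenbergVatsal2000, §3 (18)–(19) and proof of Thm. (3.10)] -/
def vatsal1999_plusSymbol_congruence : Prop :=
  ∀ (p M : ℕ) [Fact p.Prime] [NeZero M] (ι : PadicAlgCl p ≃+* ℂ) (W : WeierstrassCurve ℚ) [W.IsElliptic]
    (f g : CuspForm (Gamma0 M) 2),
    p ≠ 2 → ¬ p ∣ M → 4 ≤ M →
    -- «normalized Hecke eigenforms on Γ … with coefficients in 𝒪», Condition 1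
    IsHeckeEigenform f → IsNormalized f → FiniteDimensional ℚ (coeffField f) →
      (∀ n : ℕ, Valued.v (ι.symm (cuspCoeff f n)) ≤ 1) → HasSimpleHeckeGenEigenspace f →
    IsHeckeEigenform g → IsNormalized g → FiniteDimensional ℚ (coeffField g) →
      (∀ n : ℕ, Valued.v (ι.symm (cuspCoeff g n)) ≤ 1) → HasSimpleHeckeGenEigenspace g →
    -- «aₙ ≡ bₙ (mod π)» for all n
    (∀ n : ℕ, Valued.v (ι.symm (cuspCoeff f n - cuspCoeff g n)) < 1) →
    -- «ρ_𝔪 is irreducible», witnessed by an elliptic curve with irreducible W[p]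
    W.HasIrreducibleModPGaloisRep p →
    (∀ ℓ : ℕ, ℓ.Prime → ¬ ℓ ∣ M * p → Valued.v (ι.symm (cuspCoeff f ℓ - (W.LFunction ℓ : ℂ))) < 1) →
    ∃ Ωf Ωg : ℂ, Ωf ≠ 0 ∧ Ωg ≠ 0 ∧
      (∀ x : ℚ, Valued.v (ι.symm (plusSymbol f x / Ωf)) ≤ 1) ∧
      (∀ x : ℚ, Valued.v (ι.symm (plusSymbol g x / Ωg)) ≤ 1) ∧
      (∀ x : ℚ, Valued.v (ι.symm (plusSymbol f x / Ωf - plusSymbol g x / Ωg)) < 1) ∧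
      (∃ x : ℚ, Valued.v (ι.symm (plusSymbol f x / Ωf)) = 1)

/-- **Corollary (proved from the fact): symmetric non-vanishing.** Under the fact, the canonically normalised
plus symbol of `g` is also a unit somewhere — at the same `x` (ultrametric inequality: a unit plus an element of
the maximal ideal is a unit); this is Remark (1.12) for `* = g`. [cite: Vatsal1999, Remark (1.12)] -/
theorem vatsal1999_plusSymbol_congruence.exists_unit_right (h : vatsal1999_plusSymbol_congruence)
    (p M : ℕ) [Fact p.Prime] [NeZero M] (ι : PadicAlgCl p ≃+* ℂ) (W : WeierstrassCurve ℚ) [W.IsElliptic]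
    (f g : CuspForm (Gamma0 M) 2) (hp : p ≠ 2) (hpM : ¬ p ∣ M) (hM : 4 ≤ M)
    (hf : IsHeckeEigenform f) (hf1 : IsNormalized f) (hfK : FiniteDimensional ℚ (coeffField f))
    (hfint : ∀ n : ℕ, Valued.v (ι.symm (cuspCoeff f n)) ≤ 1) (hfC : HasSimpleHeckeGenEigenspace f)
    (hg : IsHeckeEigenform g) (hg1 : IsNormalized g) (hgK : FiniteDimensional ℚ (coeffField g))
    (hgint : ∀ n : ℕ, Valued.v (ι.symm (cuspCoeff g n)) ≤ 1) (hgC : HasSimpleHeckeGenEigenspace g)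
    (hcong : ∀ n : ℕ, Valued.v (ι.symm (cuspCoeff f n - cuspCoeff g n)) < 1)
    (hirr : W.HasIrreducibleModPGaloisRep p)
    (hW : ∀ ℓ : ℕ, ℓ.Prime → ¬ ℓ ∣ M * p → Valued.v (ι.symm (cuspCoeff f ℓ - (W.LFunction ℓ : ℂ))) < 1) :
    ∃ Ωf Ωg : ℂ, Ωf ≠ 0 ∧ Ωg ≠ 0 ∧
      (∀ x : ℚ, Valued.v (ι.symm (plusSymbol f x / Ωf - plusSymbol g x / Ωg)) < 1) ∧
      (∃ x : ℚ, Valued.v (ι.symm (plusSymbol g x / Ωg)) = 1) := by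
  obtain ⟨Ωf, Ωg, hΩf, hΩg, -, hintg, hcg, x, hx⟩ :=
    h p M ι W f g hp hpM hM hf hf1 hfK hfint hfC hg hg1 hgK hgint hgC hcong hirr hW
  refine ⟨Ωf, Ωg, hΩf, hΩg, hcg, x, ?_⟩
  -- `b = a - (a - b)` with `v a = 1`, `v (a - b) < 1`, `v b ≤ 1` ⇒ `v b = 1`
  set a := ι.symm (plusSymbol f x / Ωf) with ha
  set b := ι.symm (plusSymbol g x / Ωg) with hb
  have hab : Valued.v (a - b) < 1 := by
    have := hcg x
    simpa [ha, hb, map_sub] using this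
  refine le_antisymm (hintg x) ?_
  by_contra hlt
  rw [not_le] at hlt
  have : Valued.v a < 1 := by
    have hsum : a = (a - b) + b := by ring
    rw [hsum]
    exact lt_of_le_of_lt (Valuation.map_add _ _ _) (max_lt hab hlt)
  exact absurd hx (ne_of_lt this)

end Fact

section SemistableVariant

/-- **The semistable-at-`p` variant (Greenberg–Vatsal 2000 §3 (17)–(19) with Vatsal 1999 §1): congruent eigenforms in
the Hecke family of an elliptic curve that is GOOD ORDINARY OR MULTIPLICATIVE at `p`.** Let `p` be an odd prime and
`E/ℚ` (globally minimal `W`) an elliptic curve with good ordinary or multiplicative reduction at `p` and `E[p]`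
irreducible («admissible» sign, any); let `f₀ ∈ S₂(Γ₀(N))` be its newform (`IsNewformOf W f₀`) and `M ≥ 5` a
multiple of `N` with `p² ∤ M` (Vatsal's levels `M = N'p^s`, `s ≤ 1`, `p ∤ N'`). Let `f ∈ S₂(Γ₀(M))` be a normalised
Hecke eigenform for all `T_ℓ` with `aₙ(f) = aₙ(E)` whenever `(n, M) = 1` («any modular form of level `M` that is an
eigenform for the full Hecke algebra `T₁(M)` … and which satisfies `aₙ = bₙ` whenever `(n, M) = 1`», GV p. 33) whose
`U_p`-eigenvalue is a `p`-adic unit if `p ∣ M` («`𝔪` is ordinary», Vatsal Thm. (1.13), second bullet; for `p ∤ M`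
this is the first bullet), and let `g ∈ S₂(Γ₀(M))` be a second normalised Hecke eigenform with number-field,
`p`-integral coefficients and `aₙ(g) ≡ aₙ(f)` modulo the maximal ideal for ALL `n`; both satisfy Condition 1. For
such `𝔪` Greenberg–Vatsal's display (18) (= [Vat97] Thms. 1.3/2.7 = Vatsal's Condition 2; `p`-distinguishedness is
automatic «if `f` corresponds to an elliptic curve», GV p. 32) holds, so Vatsal (1.3)–(1.6) apply exactly as in
`vatsal1999_plusSymbol_congruence` (GV's own use: proof of Thm. (3.10), «`a'ₙ ≡ b'ₙ (mod p)` for all integers `n`.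
Theorem 1.10 of [Vat97] now yields a congruence»). CONCLUSION: the same — canonical periods `Ω_f, Ω_g ∈ ℂˣ` with
`plusSymbol f x/Ω_f`, `plusSymbol g x/Ω_g` `p`-integral for all `x ∈ ℚ`, congruent modulo the maximal ideal for all
`x`, and `plusSymbol f x/Ω_f` a unit for some `x`. Weight `2`, trivial nebentypus, sign `+`, `r = 1`.
`-- TODO(general form): GV Thm. (3.13) setting (f not attached to an elliptic curve: ρ irreducible and p-distinguished).`
[cite: GreenbergVatsal2000, §3 standing hypotheses (p. 31–32), (17)–(19), proof of Thm. (3.10)]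
[cite: Vatsal1999, §1 (1.1)–(1.6) with display (11), Remark (1.12), Thm. (1.13) both bullets] -/
def greenbergVatsal2000_plusSymbol_congruence : Prop :=
  ∀ (p M N : ℕ) [Fact p.Prime] [NeZero M] [NeZero N] (ι : PadicAlgCl p ≃+* ℂ)
    (W : WeierstrassCurve ℚ) [W.IsGloballyMinimal] [W.IsElliptic]
    (f₀ : CuspForm (Gamma0 N) 2) (f g : CuspForm (Gamma0 M) 2),
    p ≠ 2 → 5 ≤ M → N ∣ M → ¬ p ^ 2 ∣ M →
    -- «E has either good ordinary or multiplicative reduction at p», E[p] irreducible (admissible sign)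
    (IsOrdinaryAt W p ∨ W.HasMultiplicativeReductionAtPrime p) → W.HasIrreducibleModPGaloisRep p →
    -- f₀ = the newform of E (level N ∣ M); f in its Hecke family at level M: «aₙ = bₙ whenever (n, M) = 1»
    IsNewformOf W f₀ →
    IsHeckeEigenform f → IsNormalized f → FiniteDimensional ℚ (coeffField f) →
      (∀ n : ℕ, Valued.v (ι.symm (cuspCoeff f n)) ≤ 1) → HasSimpleHeckeGenEigenspace f →
      (∀ n : ℕ, Nat.Coprime n M → cuspCoeff f n = (W.LFunction n : ℂ)) →
      -- «𝔪 is ordinary» when p divides the level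
      (p ∣ M → Valued.v (ι.symm (cuspCoeff f p)) = 1) →
    IsHeckeEigenform g → IsNormalized g → FiniteDimensional ℚ (coeffField g) →
      (∀ n : ℕ, Valued.v (ι.symm (cuspCoeff g n)) ≤ 1) → HasSimpleHeckeGenEigenspace g →
    -- «aₙ ≡ bₙ (mod π)» for all n
    (∀ n : ℕ, Valued.v (ι.symm (cuspCoeff f n - cuspCoeff g n)) < 1) →
    ∃ Ωf Ωg : ℂ, Ωf ≠ 0 ∧ Ωg ≠ 0 ∧
      (∀ x : ℚ, Valued.v (ι.symm (plusSymbol f x / Ωf)) ≤ 1) ∧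
      (∀ x : ℚ, Valued.v (ι.symm (plusSymbol g x / Ωg)) ≤ 1) ∧
      (∀ x : ℚ, Valued.v (ι.symm (plusSymbol f x / Ωf - plusSymbol g x / Ωg)) < 1) ∧
      (∃ x : ℚ, Valued.v (ι.symm (plusSymbol f x / Ωf)) = 1)

end SemistableVariant

end Literature.NumberTheory.EllipticCurves.ModularForms

end
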